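import Literature.NumberTheory.Transcendental.SixExponentialsSeveralVariablesChainProofs
import Literature.NumberTheory.Transcendental.SixExponentialsSeveralVariablesCor42Proofs
import Literature.NumberTheory.Transcendental.SixExponentialsSeveralVariablesThm41Proofs
import HarnessLib

/-!
# Waldschmidt 1981: the whole chain §3 → §6 rooted at Philippon's zero estimate on `𝔾ₘ^d`

Topic `Literature/NumberTheory/Transcendental`; sibling proof file of
`SixExponentialsSeveralVariablesSteps.lean` / `SixExponentialsSeveralVariables.lean` (the named
facts `Waldschmidt1981.cor_4_2`, `prop_6_1`, `thm_1_1`, `thm_2_1` of [Waldschmidt1981]).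

Every deduction printed in [Waldschmidt1981] between its transcendence input and its main
theorems is now proved in the tree, in separate sibling files:

* `cor_3_2_holds` (§3, auxiliary function; `SixExponentialsSeveralVariablesAuxiliary.lean`);
* `thm_4_1_of_zeroEstimate_torus : Philippon1986_zeroEstimate_torus → thm_4_1` (§4, Théorème 4.1
  = [Masser1981, Theorem 2], deduced as in [NesterenkoPhilippon2001, Ch. 11, Cor. 4.2 and the
  remark on `𝔾ₘⁿ`, pp. 221–222]; `SixExponentialsSeveralVariablesThm41Proofs.lean`);
* `cor_4_2_of_thm_4_1 : thm_4_1 → cor_4_2` (§4, p. 105: Cor. 3.2 + Thm 4.1 + Liouville;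
  `SixExponentialsSeveralVariablesCor42Proofs.lean`);
* `prop_6_1_of_cor_4_2 : cor_4_2 → prop_6_1` (§5 Lemmes 5.1–5.4 and §6 a), pp. 106–109;
  `SixExponentialsSeveralVariablesProp61Proofs.lean`);
* `thm_1_1_of_cor_4_2`, `thm_2_1_of_cor_4_2` (§6 a), c), pp. 109–111;
  `SixExponentialsSeveralVariablesChainProofs.lean`).

This leaf file only composes them, so that each of the four named facts is visibly reduced to the
single un-discharged input below the whole paper, Philippon's multiplicity-free zero estimate on
the torus (`Literature.NumberTheory.Transcendental.Philippon1986_zeroEstimate_torus`,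
`TorusZeroEstimate.lean`; [Philippon1986, Thm 2.1], [NesterenkoPhilippon2001, Ch. 11 Thm 4.1]):

`cor_4_2_of_zeroEstimate_torus`, `prop_6_1_of_zeroEstimate_torus`,
`thm_1_1_of_zeroEstimate_torus`, `thm_2_1_of_zeroEstimate_torus`.

The discharges are then the one-liners
`prop_6_1_holds := prop_6_1_of_zeroEstimate_torus Philippon1986_zeroEstimate_torus_holds` (etc.),
to be appended here once `Philippon1986_zeroEstimate_torus_holds` exists. Nothing new is
asserted; no statement is changed.

## References

* [Waldschmidt1981] M. Waldschmidt, *Transcendance et exponentielles en plusieurs variables*,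
  Invent. Math. 63 (1981) 97–127, doi:10.1007/bf01389195: Cor. 3.2 (pp. 101–102), Thm 4.1 and
  Cor. 4.2 (p. 105), §5 (pp. 106–109), Prop. 6.1 and §6 a), c) (pp. 109–111).
* [Masser1981] D. W. Masser, *On polynomials and exponential polynomials in several complex
  variables*, Invent. Math. 63 (1981) 81–95, Theorem 2 (pp. 82–83).
* [Philippon1986] P. Philippon, *Lemmes de zéros dans les groupes algébriques commutatifs*,
  Bull. Soc. Math. France 114 (1986) 355–383, Théorème 2.1.
* [NesterenkoPhilippon2001] Yu. V. Nesterenko, P. Philippon (eds.), *Introduction to Algebraic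
  Independence Theory*, LNM 1752, Springer 2001, Ch. 11 (D. Roy), Thm 4.1 (p. 218), Cor. 4.2
  (pp. 221–222).
-/

noncomputable section

namespace Literature.NumberTheory.Transcendental.Waldschmidt1981

/-- **Corollaire 4.2 from the torus zero estimate**: Théorème 4.1 from Philippon's zero
estimate on `𝔾ₘ^d` (`thm_4_1_of_zeroEstimate_torus`), then Corollaire 4.2 from Théorème 4.1,
Corollaire 3.2 (proved) and Liouville (`cor_4_2_of_thm_4_1`).
[cite: Waldschmidt1981, §4 Corollaire 4.2 (p. 105)]
[cite: NesterenkoPhilippon2001, Ch. 11 Cor. 4.2 and remark on 𝔾ₘⁿ (pp. 221–222)] -/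
theorem cor_4_2_of_zeroEstimate_torus (hZ : Philippon1986_zeroEstimate_torus) : cor_4_2 :=
  cor_4_2_of_thm_4_1 (thm_4_1_of_zeroEstimate_torus hZ)

/-- **Proposition 6.1 from the torus zero estimate**: the composite of
`cor_4_2_of_zeroEstimate_torus` with the algebra of §5 and §6 a) (`prop_6_1_of_cor_4_2`).
[cite: Waldschmidt1981, §6 a) Proposition 6.1 (p. 109)] -/
theorem prop_6_1_of_zeroEstimate_torus (hZ : Philippon1986_zeroEstimate_torus) : prop_6_1 :=
  prop_6_1_of_cor_4_2 (cor_4_2_of_zeroEstimate_torus hZ)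

/-- **Théorème 1.1 (six exponentials in several variables) from the torus zero estimate**.
[cite: Waldschmidt1981, §1 Théorème 1.1 (p. 98); §6 a) (pp. 109–110)] -/
theorem thm_1_1_of_zeroEstimate_torus (hZ : Philippon1986_zeroEstimate_torus) : thm_1_1 :=
  thm_1_1_of_cor_4_2 (cor_4_2_of_zeroEstimate_torus hZ)

/-- **Théorème 2.1 (matrix form) from the torus zero estimate**.
[cite: Waldschmidt1981, §2 Théorème 2.1 (p. 100); §6 c) (p. 111)] -/
theorem thm_2_1_of_zeroEstimate_torus (hZ : Philippon1986_zeroEstimate_torus) : thm_2_1 :=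
  thm_2_1_of_cor_4_2 (cor_4_2_of_zeroEstimate_torus hZ)

end Literature.NumberTheory.Transcendental.Waldschmidt1981

end
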